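import Mathlib
import HarnessLib
import Summits.ResolutionOfSingularities.ResolutionOfSingularities.Theorems.WildQuotientsWildQuotientResolutionS1aKillTouch
import Summits.ResolutionOfSingularities.ResolutionOfSingularities.Theorems.WildQuotientsWildQuotientResolutionS1aTopComponents

/-!
# S1a — THE ONE-ORBIT AUX FORM `AuxOrbitAt` (one top component of the non-killable locus at a time) and its measure `(jInf, topCount)`

[OURS · L1 W4.5c · lead-1 g9] — NOT statements of the manuscript; counted 0; AI-level work, weaker than expert review. Crux
stmt-ResolutionOfSingularities-17941, line `s1a-logminvertex` v8 → v9 (lead reshape of the A stub). Route-independent.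

WHY. `AuxTopAt M` (p613609) asks for ONE aux centre whose support contains ALL top-dimensional components of `nonKillable M` (a `Z` with
`dim (nonKillable ∖ Z) < jInf`), so that `jInf` drops in one move. When two top components MEET (plan-1ʼs untested regime F-TRI4: special lines meeting in
a point) one weighted regular centre through the meeting point must contain both germs. The ONE-ORBIT form asks the support to contain SOME top
component only; the price is the secondary measure `topCount M` := the number of top-dimensional irreducible components of `nonKillable M`, which such
a move lowers when `jInf` does not drop:
* topology: `topComponents X` / `nTopComp X`, `eq_of_subset_of_topologicalKrullDim_eq` (an irreducible closed set of full finite dimension inside an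
  irreducible set is all of it), `closure_image_mem_topComponents`, ★ `nTopComp_lt_of_isEmbedding` (an embedding `ψ : Y → X` of spaces of the same
  finite dimension whose range misses a top component `t ⊆ F` (`F` disjoint from the range) has `nTopComp Y < nTopComp X`: `T' ↦ closure (ψ '' T')`
  is injective on top components and misses `t`);
* models: `topCount M`, `topCount_eq_zero_of_jInf_eq_bot`, ★ `exists_isEmbedding_nonKillable_of_killable_over_support` (the gen-8 inducing map of (A3) is
  an EMBEDDING with range off the support), **`AuxOrbitAt M`** (research def: aux centre, SOME top component of `nonKillable` inside the support,
  every bad point over the support killable after every move); ★ `lex_lt_of_move_of_killable_over_support` / `lex_lt_of_move_of_auxOrbitAt`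
  (`jInf' < jInf ∨ (jInf' = jInf ∧ topCount' < topCount)` along every move). No implication between `AuxTopAt` and `AuxOrbitAt` is claimed here.
The bounded-sequence form `AuxOrbitWithin`, the research statement `AuxWithinReach` and the winning induction are `…S1aOrbitRule`.
-/

set_option linter.dupNamespace false

noncomputable section

universe u v

open CategoryTheory Limits AlgebraicGeometry TopologicalSpace Topology
open Literature.AlgebraicGeometry.Resolution Literature.AlgebraicGeometry.RelativeSpec
open Summit.ResolutionOfSingularities.ResolutionOfSingularities.Theorems.WildQuotientResolution.S1
open Summit.ResolutionOfSingularities.ResolutionOfSingularities.Theorems.WildQuotientResolution.S1.NodeAtlas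
open Summit.ResolutionOfSingularities.ResolutionOfSingularities.Theorems.WildQuotientResolution.S1.BlowupCharts
open Summit.ResolutionOfSingularities.ResolutionOfSingularities.Theorems.WildQuotientResolution.S1.G1Proof
open Summit.ResolutionOfSingularities.ResolutionOfSingularities.Theorems.WildQuotientResolution.S1.KillableTransport
open Summit.ResolutionOfSingularities.ResolutionOfSingularities.Theorems.WildQuotientResolution.S1.CompCount
open Summit.ResolutionOfSingularities.ResolutionOfSingularities.Theorems.WildQuotientResolution.S1.TopComponents

namespace Summit.ResolutionOfSingularities.ResolutionOfSingularities.Theorems.WildQuotientResolution.S1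

/-! ## Topology: top-dimensional components under an embedding -/

namespace TopCount

variable {X : Type u} {Y : Type v} [TopologicalSpace X] [TopologicalSpace Y]

/-- **The irreducible components of full dimension.** [OURS · L1 W4.5c] -/
def topComponents (X : Type u) [TopologicalSpace X] : Set (Set X) :=
  {t ∈ irreducibleComponents X | topologicalKrullDim ↥t = topologicalKrullDim X}

/-- **The number of irreducible components of full dimension** (`0` if infinitely many). [OURS · L1 W4.5c] -/
def nTopComp (X : Type u) [TopologicalSpace X] : ℕ := (topComponents X).ncard

/-- `topComponents ⊆ irreducibleComponents`. -/
theorem topComponents_subset (X : Type u) [TopologicalSpace X] : topComponents X ⊆ irreducibleComponents X := fun _ h => h.1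

/-- In an empty space there are no top components. -/
theorem nTopComp_eq_zero_of_isEmpty [IsEmpty X] : nTopComp X = 0 := by
  have h : topComponents X = ∅ := by
    rw [Set.eq_empty_iff_forall_notMem]
    intro t ht
    obtain ⟨x, -⟩ := ht.1.1.nonempty
    exact isEmptyElim x
  rw [nTopComp, h, Set.ncard_empty]

/-- **An irreducible closed subset of full finite dimension of an irreducible set is the whole set**: `A ⊆ B`, `A` closed, `B` irreducible,
`dim A = k`, `dim B ≤ k` (`k : ℕ`) ⇒ `A = B` (a longest chain in `A` extended by `B` would be too long). [OURS · L1 W4.5c] -/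
theorem eq_of_subset_of_topologicalKrullDim_eq {A B : Set X} (hAB : A ⊆ B) (hA : IsClosed A) (hB : IsIrreducible B) {k : ℕ}
    (hdA : topologicalKrullDim ↥A = k) (hdB : topologicalKrullDim ↥B ≤ k) : A = B := by
  by_contra hne
  obtain ⟨x₀, hx₀B, hx₀A⟩ : ∃ x, x ∈ B ∧ x ∉ A := by
    by_contra h
    push Not at h
    exact hne (Set.Subset.antisymm hAB fun x hx => h x hx)
  -- a chain of length `k` in `A`
  have hk : (k : WithBot ℕ∞) ≤ topologicalKrullDim ↥A := hdA.ge
  rw [topologicalKrullDim] at hk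
  have hk' : ((k : ℕ∞) : WithBot ℕ∞) ≤ Order.krullDim (IrreducibleCloseds ↥A) := by exact_mod_cast hk
  obtain ⟨l, hl⟩ := Order.le_krullDim_iff.mp hk'
  -- push it into `B`
  let ι : ↥A → ↥B := Set.inclusion hAB
  have hι : IsInducing ι := (IsEmbedding.inclusion hAB).isInducing
  have hF : StrictMono (IrreducibleCloseds.map ι hι.continuous) := IrreducibleCloseds.map_strictMono_of_isInducing hι
  let l₁ := l.map _ hF
  -- its last member misses `x₀`
  have hlast : ((l₁.last : IrreducibleCloseds ↥B) : Set ↥B) ⊆ {b | (b : X) ∈ A} := by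
    rw [LTSeries.last_map, IrreducibleCloseds.coe_map]
    refine closure_minimal ?_ (hA.preimage continuous_subtype_val)
    rintro _ ⟨y, -, rfl⟩
    exact y.2
  -- append the whole of `B`
  haveI : IrreducibleSpace ↥B := (isIrreducible_iff_irreducibleSpace (s := B)).mp hB
  let T : IrreducibleCloseds ↥B := ⟨Set.univ, IrreducibleSpace.isIrreducible_univ _, isClosed_univ⟩
  have hlt : l₁.last < T := by
    refine lt_of_le_of_ne (fun _ _ => Set.mem_univ _) fun h => ?_
    have : (⟨x₀, hx₀B⟩ : ↥B) ∈ (l₁.last : Set ↥B) := by rw [h]; exact Set.mem_univ _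
    exact hx₀A (hlast this)
  have h1 := Order.LTSeries.length_le_krullDim (l₁.snoc T hlt)
  simp only [RelSeries.snoc_length, LTSeries.map_length, l₁, hl] at h1
  have h2 : ((k + 1 : ℕ) : WithBot ℕ∞) ≤ topologicalKrullDim ↥B := by rw [topologicalKrullDim]; exact_mod_cast h1
  have h3 : ((k + 1 : ℕ) : WithBot ℕ∞) ≤ (k : WithBot ℕ∞) := h2.trans hdB
  have h4 : k + 1 ≤ k := by exact_mod_cast h3
  omega

/-- **The closure of the image of a top component under an embedding of spaces of the same finite dimension is a top component.**
[OURS · L1 W4.5c] -/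
theorem closure_image_mem_topComponents {ψ : Y → X} (hψ : IsEmbedding ψ) {k : ℕ} (hX : topologicalKrullDim X ≤ k)
    {T' : Set Y} (hT' : T' ∈ irreducibleComponents Y) (hdT' : topologicalKrullDim ↥T' = k) :
    closure (ψ '' T') ∈ irreducibleComponents X ∧ topologicalKrullDim ↥(closure (ψ '' T')) = k := by
  have hirr : IsIrreducible (closure (ψ '' T')) := (hT'.1.image ψ hψ.continuous.continuousOn).closure
  -- dimension `= k`: `T'` embeds into the closure of its image
  have hmem : ∀ y : ↥T', ψ y.1 ∈ closure (ψ '' T') := fun y => subset_closure ⟨y.1, y.2, rfl⟩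
  have hind : IsInducing (fun y : ↥T' => (⟨ψ y.1, hmem y⟩ : ↥(closure (ψ '' T')))) :=
    (hψ.isInducing.comp IsInducing.subtypeVal).codRestrict hmem
  have hdim : topologicalKrullDim ↥(closure (ψ '' T')) = k :=
    le_antisymm ((topologicalKrullDim_subspace_le X _).trans hX) (hdT' ▸ hind.topologicalKrullDim_le)
  refine ⟨⟨hirr, fun u hu hsub => ?_⟩, hdim⟩
  -- maximality: an irreducible `u ⊇ closure (ψ '' T')` has closure of dimension `≤ k`, hence equal
  have hcu : IsIrreducible (closure u) := hu.closure
  have heq := eq_of_subset_of_topologicalKrullDim_eq (hsub.trans subset_closure) isClosed_closure hcu hdim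
    ((topologicalKrullDim_subspace_le X _).trans hX)
  exact subset_closure.trans heq.symm.subset

/-- For an embedding, the image of a closed set is the trace of its closure on the range. -/
theorem image_eq_closure_inter_range {ψ : Y → X} (hψ : IsEmbedding ψ) {T' : Set Y} (hT'c : IsClosed T') :
    ψ '' T' = closure (ψ '' T') ∩ Set.range ψ := by
  conv_lhs => rw [← hT'c.closure_eq, hψ.isInducing.closure_eq_preimage_closure_image, Set.image_preimage_eq_inter_range]

/-- ★ **An embedding of spaces of the same finite dimension whose range misses a top component lowers the number of top components**: if
`ψ : Y → X` is an embedding, `dim X = dim Y = k`, `X` has finitely many irreducible components, and some top component `t` of `X` lies in a set `F`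
disjoint from the range of `ψ`, then `nTopComp Y < nTopComp X`. [OURS · L1 W4.5c] -/
theorem nTopComp_lt_of_isEmbedding {ψ : Y → X} (hψ : IsEmbedding ψ) {k : ℕ} (hX : topologicalKrullDim X = k) (hY : topologicalKrullDim Y = k)
    (hfin : (irreducibleComponents X).Finite) {F : Set X} (hF : Disjoint (Set.range ψ) F)
    {t : Set X} (ht : t ∈ irreducibleComponents X) (hdt : topologicalKrullDim ↥t = k) (htF : t ⊆ F) :
    nTopComp Y < nTopComp X := by
  let Φ : Set Y → Set X := fun T' => closure (ψ '' T')
  -- `Φ` maps top components of `Y` to top components of `X` other than `t`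
  have hmaps : Set.MapsTo Φ (topComponents Y) (topComponents X \ {t}) := by
    intro T' hT'
    have hdT' : topologicalKrullDim ↥T' = k := hT'.2.trans hY
    obtain ⟨hmem, hdim⟩ := closure_image_mem_topComponents hψ hX.le hT'.1 hdT'
    refine ⟨⟨hmem, hdim.trans hX.symm⟩, fun h => ?_⟩
    rw [Set.mem_singleton_iff] at h
    obtain ⟨y, hy⟩ := hT'.1.1.nonempty
    have h1 : ψ y ∈ t := h ▸ subset_closure ⟨y, hy, rfl⟩
    exact Set.disjoint_left.mp hF ⟨y, rfl⟩ (htF h1)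
  -- and is injective there
  have hinj : Set.InjOn Φ (topComponents Y) := by
    intro T₁ hT₁ T₂ hT₂ h
    have h1 := image_eq_closure_inter_range hψ (isClosed_of_mem_irreducibleComponents _ hT₁.1)
    have h2 := image_eq_closure_inter_range hψ (isClosed_of_mem_irreducibleComponents _ hT₂.1)
    have h3 : ψ '' T₁ = ψ '' T₂ := by rw [h1, h2]; exact congrArg (· ∩ Set.range ψ) h
    exact hψ.injective.image_injective h3
  have hfinX : (topComponents X).Finite := hfin.subset (topComponents_subset X)
  have htmem : t ∈ topComponents X := ⟨ht, hdt.trans hX.symm⟩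
  calc nTopComp Y = (topComponents Y).ncard := rfl
    _ = (Φ '' topComponents Y).ncard := (hinj.ncard_image).symm
    _ ≤ (topComponents X \ {t}).ncard := Set.ncard_le_ncard hmaps.image_subset hfinX.sdiff
    _ < (topComponents X).ncard := Set.ncard_sdiff_singleton_lt_of_mem htmem hfinX
    _ = nTopComp X := rfl

end TopCount

/-! ## Models: `topCount`, `AuxOrbitAt`, and the lexicographic drop -/

namespace GameFrame.GModel

open TopCount

variable {p : ℕ} {X' X₁ : Scheme.{0}} {q : X' ⟶ X₁} {G : Type} [Group G] {ρ : G →* Aut X'} {g₀ : G}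

/-- **`topCount M`** := the number of irreducible components of `nonKillable M` of full dimension `jInf M` — the secondary AUX measure of the
one-orbit form. [OURS · L1 W4.5c] -/
def topCount (M : GModel p q G ρ g₀) : ℕ := nTopComp ↥M.nonKillable

/-- At an all-killable model (`jInf = ⊥`, i.e. `nonKillable = ∅`) the top count is `0`. -/
theorem topCount_eq_zero_of_jInf_eq_bot (M : GModel p q G ρ g₀) (h : M.jInf = ⊥) : M.topCount = 0 := by
  rw [jInf, topologicalKrullDim, Order.krullDim_eq_bot_iff] at h
  haveI : IsEmpty ↥M.nonKillable := by
    refine ⟨fun x => ?_⟩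
    exact h.elim ⟨closure {x}, isIrreducible_singleton.closure, isClosed_closure⟩
  exact nTopComp_eq_zero_of_isEmpty

/-- **`AuxOrbitAt M`** (OURS CANDIDATE research statement, asserted nowhere; the ONE-ORBIT form of `AuxTopAt`): there are an AUX centre `(𝒦, d)`
(admissible, principal-or-idle at the good points) whose SUPPORT CONTAINS SOME irreducible component of `nonKillable M` of full dimension `jInf M`
(hence its whole `G`-orbit, the support being `G`-stable), such that along every move of `(𝒦, d)` every BAD point over the support is KILLABLE.
Nothing is asked off the support, nothing about the other top components. Census recipes meeting it per transversal type: recipe table v3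
(STRATEGY-DESIGN v3.6 §2). [OURS · L1 W4.5c] -/
def AuxOrbitAt (M : GModel p q G ρ g₀) : Prop :=
  ∃ (𝒦 : ReesFiltration M.V) (d : ℕ), IsAuxCentre p M.act g₀ 𝒦 d (M.badLocus)ᶜ ∧
    (∃ t ∈ irreducibleComponents ↥M.nonKillable, topologicalKrullDim ↥t = M.jInf ∧
      Subtype.val '' t ⊆ ((𝒦.ideal d).support : Set M.V)) ∧
    ∀ (M' : GModel p q G ρ g₀) (π' : M'.V ⟶ M.V), IsBlowup π' (𝒦.ideal d) → M'.π = π' ≫ M.π → M'.r = π' ≫ M.r →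
      (∀ g : G, (M'.act.aut g).hom ≫ π' = π' ≫ (M.act.aut g).hom) →
      ∀ v' ∈ M'.badLocus, π'.base v' ∈ ((𝒦.ideal d).support : Set M.V) → M'.KillableAt v'

/-- ★ **THE NON-KILLABLE LOCUS OF A MOVE KILLABLE OVER THE SUPPORT EMBEDS INTO `nonKillable M`, OFF THE SUPPORT** (the inducing map of
`exists_isInducing_nonKillable_diff`, p613609, is injective). [OURS · L1 W4.5c] -/
theorem exists_isEmbedding_nonKillable_of_killable_over_support [Finite G] (hp : p.Prime) (hG : ∀ g : G, g ∈ Subgroup.zpowers g₀)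
    (M M' : GModel p q G ρ g₀) (hB : M.HasNoetherianBase) (𝒦 : ReesFiltration M.V) (d : ℕ)
    (h𝒦G : ∀ g : G, (𝒦.ideal d).comap (M.act.aut g).hom = 𝒦.ideal d)
    (π' : M'.V ⟶ M.V) (hbl : IsBlowup π' (𝒦.ideal d)) (hr : M'.r = π' ≫ M.r)
    (hcomm : ∀ g : G, (M'.act.aut g).hom ≫ π' = π' ≫ (M.act.aut g).hom)
    (hkill : ∀ v' ∈ M'.badLocus, π'.base v' ∈ ((𝒦.ideal d).support : Set M.V) → M'.KillableAt v') :
    ∃ ψ : ↥M'.nonKillable → ↥M.nonKillable, IsEmbedding ψ ∧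
      ∀ v', (ψ v' : M.V) = π'.base v'.1 ∧ (ψ v' : M.V) ∉ ((𝒦.ideal d).support : Set M.V) := by
  have hsuppG := fun g => preimage_support_compl_of_comap_eq M (I := 𝒦.ideal d) h𝒦G g
  let W : M.V.Opens := (𝒦.ideal d).support.compl
  have hW : ∀ v' : ↥M'.nonKillable, v'.1 ∈ π' ⁻¹ᵁ W := fun v' hs => v'.2.2 (hkill v'.1 v'.2.1 hs)
  have key : ∀ v' : ↥M'.nonKillable, π'.base v'.1 ∈ M.nonKillable := fun v' => by
    have hvW : π'.base v'.1 ∉ ((𝒦.ideal d).support : Set M.V) := hW v'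
    have hbad : π'.base v'.1 ∈ M.badLocus := base_mem_badLocus_of_move M M' hG 𝒦 d π' hbl hr hcomm hsuppG hvW v'.2.1
    refine ⟨hbad, fun ⟨𝒦₂, d₂, O₂, hd₂, hvO₂, hO₂⟩ => v'.2.2 ?_⟩
    have hvs : π'.base v'.1 ∈ ((𝒦₂.ideal d₂).support : Set M.V) := g1 hp q G ρ g₀ hG M 𝒦₂ d₂ O₂ hB hO₂ _ hvO₂ hbad
    exact killableAt_of_move_of_mem_support M M' 𝒦 d π' hbl hr hcomm hsuppG hvW hO₂ hd₂ hvO₂ hvs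
  haveI hiso : IsIso (π' ∣_ W) := hbl.isIso_morphismRestrict (U := W) (by
    rw [Set.disjoint_iff]; rintro x ⟨hx, hx'⟩; exact hx hx')
  let e : ↥(π' ⁻¹ᵁ W) ≃ₜ ↥W := Scheme.homeoOfIso (asIso (π' ∣_ W))
  let φ₀ : ↥M'.nonKillable → M.V := fun v' => ((e ⟨v'.1, hW v'⟩ : ↥W) : M.V)
  have hφ₀ : ∀ v', φ₀ v' = π'.base v'.1 := fun v' => by
    have h1 : (e ⟨v'.1, hW v'⟩ : ↥W) = (π' ∣_ W).base ⟨v'.1, hW v'⟩ := rfl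
    change ((e ⟨v'.1, hW v'⟩ : ↥W) : M.V) = _
    rw [h1]
    exact morphismRestrict_base_coe π' W ⟨v'.1, hW v'⟩
  have hind₀ : IsInducing φ₀ := by
    refine IsInducing.subtypeVal.comp (e.isInducing.comp ?_)
    exact (IsInducing.subtypeVal.codRestrict hW : IsInducing fun v' : ↥M'.nonKillable => (⟨v'.1, hW v'⟩ : ↥(π' ⁻¹ᵁ W)))
  have hinj₀ : Function.Injective φ₀ := by
    intro a b hab
    have h1 : (e ⟨a.1, hW a⟩ : ↥W) = e ⟨b.1, hW b⟩ := Subtype.ext hab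
    have h2 := e.injective h1
    exact Subtype.ext (congrArg (fun x : ↥(π' ⁻¹ᵁ W) => (x : M'.V)) h2)
  have hmem₀ : ∀ v', φ₀ v' ∈ M.nonKillable := fun v' => by rw [hφ₀]; exact key v'
  refine ⟨Set.codRestrict φ₀ M.nonKillable hmem₀, ⟨hind₀.codRestrict hmem₀, (Set.injective_codRestrict hmem₀).mpr hinj₀⟩, fun v' => ⟨hφ₀ v', ?_⟩⟩
  change φ₀ v' ∉ _
  rw [hφ₀]
  exact hW v'

/-- ★ **THE LEXICOGRAPHIC DROP along every move of a one-orbit aux datum**: `jInf' < jInf`, or `jInf' = jInf` and `topCount' < topCount`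
(over a Noetherian base, quasi-compact model, `jInf = k` finite; the centre `(𝒦, d)` `G`-stable, its support containing a top component `t` of
`nonKillable M`, every bad point over the support killable after the move). [OURS · L1 W4.5c] -/
theorem lex_lt_of_move_of_killable_over_support [Finite G] (hp : p.Prime) (hG : ∀ g : G, g ∈ Subgroup.zpowers g₀) (M M' : GModel p q G ρ g₀)
    (hB : M.HasNoetherianBase) [CompactSpace M.V] {k : ℕ} (hk : M.jInf = k) (𝒦 : ReesFiltration M.V) (d : ℕ)
    (h𝒦G : ∀ g : G, (𝒦.ideal d).comap (M.act.aut g).hom = 𝒦.ideal d)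
    {t : Set ↥M.nonKillable} (ht : t ∈ irreducibleComponents ↥M.nonKillable) (hdt : topologicalKrullDim ↥t = M.jInf)
    (htsupp : Subtype.val '' t ⊆ ((𝒦.ideal d).support : Set M.V))
    (π' : M'.V ⟶ M.V) (hbl : IsBlowup π' (𝒦.ideal d)) (hr : M'.r = π' ≫ M.r)
    (hcomm : ∀ g : G, (M'.act.aut g).hom ≫ π' = π' ≫ (M.act.aut g).hom)
    (hkill : ∀ v' ∈ M'.badLocus, π'.base v' ∈ ((𝒦.ideal d).support : Set M.V) → M'.KillableAt v') :
    M'.jInf < M.jInf ∨ (M'.jInf = M.jInf ∧ M'.topCount < M.topCount) := by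
  obtain ⟨ψ, hψ, hψ'⟩ := exists_isEmbedding_nonKillable_of_killable_over_support hp hG M M' hB 𝒦 d h𝒦G π' hbl hr hcomm hkill
  have hle : M'.jInf ≤ M.jInf := hψ.isInducing.topologicalKrullDim_le
  rcases hle.lt_or_eq with hlt | heq
  · exact Or.inl hlt
  · refine Or.inr ⟨heq, ?_⟩
    -- the range of `ψ` misses the support, which contains the top component `t`
    let F : Set ↥M.nonKillable := {z | (z : M.V) ∈ ((𝒦.ideal d).support : Set M.V)}
    have hF : Disjoint (Set.range ψ) F := by
      rw [Set.disjoint_left]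
      rintro _ ⟨v', rfl⟩ hz
      exact (hψ' v').2 hz
    have htF : t ⊆ F := fun z hz => htsupp ⟨z, hz, rfl⟩
    exact nTopComp_lt_of_isEmbedding hψ hk (heq.trans hk) M.finite_irreducibleComponents_nonKillable hF ht (hdt.trans hk) htF

/-- ★ **`AuxOrbitAt M` lowers `(jInf, topCount)` lexicographically along every move.** [OURS · L1 W4.5c] -/
theorem lex_lt_of_move_of_auxOrbitAt [Finite G] (hp : p.Prime) (hG : ∀ g : G, g ∈ Subgroup.zpowers g₀) (M : GModel p q G ρ g₀)
    (hB : M.HasNoetherianBase) [CompactSpace M.V] {k : ℕ} (hk : M.jInf = k) (h : M.AuxOrbitAt) :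
    ∃ (𝒦 : ReesFiltration M.V) (d : ℕ), IsAuxCentre p M.act g₀ 𝒦 d (M.badLocus)ᶜ ∧
      ∀ M' : GModel p q G ρ g₀, M.IsMoveOf M' 𝒦 d → M'.jInf < M.jInf ∨ (M'.jInf = M.jInf ∧ M'.topCount < M.topCount) := by
  obtain ⟨𝒦, d, haux, ⟨t, ht, hdt, htsupp⟩, hkill⟩ := h
  refine ⟨𝒦, d, haux, fun M' hmv => ?_⟩
  obtain ⟨π', hbl, hπ, hr, hcomm⟩ := hmv
  exact lex_lt_of_move_of_killable_over_support hp hG M M' hB hk 𝒦 d (fun g => haux.1.2.1 g d) ht hdt htsupp π' hbl hr hcomm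
    (hkill M' π' hbl hπ hr hcomm)

end GameFrame.GModel

end Summit.ResolutionOfSingularities.ResolutionOfSingularities.Theorems.WildQuotientResolution.S1

end
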